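/-
Copyright: the b2b-balaban cell (near-miss cell 7), T⁴-continuum fan-out; row NE7b swarm table S10 (TH form, ruling
R-OWNER-22-1, item F-S10-price-TH — the `Refines` half), supplied by the swarm seat `t4-ne7b-formalise-leaf-07`.
Released under the licence of the surrounding project.
-/
import Summits.QuantumFields.BalabanUV.T4Continuum.Support.HistoryConstantsExist
import Summits.QuantumFields.BalabanUV.T4Continuum.Support.HistorySocketTH

/-!
# Row NE7b, leaf S10 on the TREE COUNT: the socket `LiveHistoriesTH` transfers along a refinement of the constants

Summits-side support leaf of the T⁴-continuum cell (rung (B)+1 on a FINITE torus only; NOT infinite volume, NOT the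
mass gap, NOT the Clay statement; NOT a proof of the spine estimate NE7b).  Claim table
`t4/b2b-balaban-t4-ne7b-p1/LEAVES-NE7b.md` row S10, item F-S10-price-TH (the `Refines` half; the `Dominates` half is
leaf-04's `HistoryConstantsTH`), for the socket of ruling R-OWNER-22-1∕R2: `HistorySocketTH.LiveHistoriesTH` over
TAGGED genealogies read through a shape map `sh : ε → PEv`, priced by `HistorySocketTH.shapeTH` (the TH exit's
`hlabTH` right-hand side).  [folklore] real arithmetic and finite sums over the lineage's OWN carrier; nothing quoted
from print, nothing printed asserted, no `def … : Prop` fact minted (c1), no numerals (c2∕c6).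

WHAT.  §1 along `HistoryConstantsExist.Refines C Cp` the TAGGED tables of `T4TaggedShapeBanking` are monotone exactly
as the untagged ones: `dictWT` coincides, `costT_le`, `lifeCostT_le` (ANY window table — so the padded table
`padW (dictWT …) D` of the TH exit is covered), `consistentTH_iff_of_n₁_eq` (late-merger consistency reads only `n₁`),
`creditsT_le`, hence **`shapeTH_le`**: the TH price shape does not decrease along a refinement (events dated `≤ K`,
profile base nonnegative).  §2 **`liveHistoriesTH_of_refines`**: `Refines C Cp → LiveHistoriesTH sh Cp … live →
LiveHistoriesTH sh C … live` (same live data; `Δ ≥ 0`, `Λ′ ≥ 0`, profile base `≥ 0` along the runs),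
`liveHistoriesTH_withMargins`, and the END in use form **`relWeightBound_of_liveHistoriesTH_refines`** =
`HistorySocketTH.relWeightBound_of_liveHistoriesTH` with the socket supplied at the transcription's record `Cp` and every
other binder at a refining `C` — conclusion verbatim.  §3 sanity.

USE (row S12).  Fill `LiveHistoriesTH` at the record the transcription prices (leaf-04's `printedConsts O C`, or
`lowerA _ θ` after the zone surcharge of row S6e), choose the count margins, `C := withMargins … κ₁ E₀ Eb μ`, and call
`relWeightBound_of_liveHistoriesTH_refines (refines_withMargins _)` with `thresholdOK_withMargins`.

HONEST DEPENDENCY (cell): continuum YM on T⁴ ⇐ BetaPertH ∧ nine spine estimates (0/9 proved); BetaPertH ⇐ (D1) ∧ (D4)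
∧ CAP+tail.  This file changes none of it.
-/

open Finset
open Literature.MathematicalPhysics.QuantumFieldTheory.Balaban1983to89
open T4PersistenceDictionary T4PersistentHistoryCount T4BankedInduction T4PrintedShapeBanking T4PartnerMultiplicity
open T4WeightBudget T4GlobalDenominator T4LiveClassFibration T4LiveStructureGas T4LiveGasToTerms T4RecordPriceSeam
open T4BranchingRecordsGas T4TaggedShapeBanking T4CanonicalMenus T4CountHorizon
open Summit.QuantumFields.BalabanUV.T4Continuum.PlacementBatch
open Summit.QuantumFields.BalabanUV.T4Continuum.CountThresholdUniform
open Summit.QuantumFields.BalabanUV.T4Continuum.CountThresholdExit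
open Summit.QuantumFields.BalabanUV.T4Continuum.LateMergers
open Summit.QuantumFields.BalabanUV.T4Continuum.HistoryConstantsExist
open Summit.QuantumFields.BalabanUV.T4Continuum.HistorySocketTH

namespace Summit.QuantumFields.BalabanUV.T4Continuum.HistoryConstantsExistTH

noncomputable section

variable {ε : Type*} [DecidableEq ε]

/-! ## §1 Along a refinement: the tagged tables and the TH price shape are monotone -/

section Tables

variable {sh : ε → PEv} {C Cp : T4PrintedShapeBanking.Consts}

omit [DecidableEq ε] in
/-- the tagged windows coincide along a refinement [folklore] -/
theorem dictWT_eq (h : Refines C Cp) (R : ℕ → ℕ) : dictWT sh R C.n₁ = dictWT sh R Cp.n₁ := by rw [h.n₁_eq]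

/-- **THE TAGGED PER-STEP COST DOES NOT DECREASE** along a refinement. [folklore] -/
theorem costT_le (h : Refines C Cp) (K : ℕ) (R : ℕ → ℕ) (G : Gen ε) (n : ℕ) :
    costT sh Cp K R G n ≤ costT sh C K R G n := by
  unfold costT; rw [dictWT_eq h]
  exact sum_le_sum fun e _ => add_le_add (wfloor_le h K R _ (sh e) n) (sz_le h K R (sh e) n)

/-- **THE TAGGED LIFE COST DOES NOT DECREASE** along a refinement, over ANY window table (the padded one included).
[folklore] -/
theorem lifeCostT_le (h : Refines C Cp) (W : ε → ℕ) (K : ℕ) (R : ℕ → ℕ) (G : Gen ε) :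
    lifeCost W (costT sh Cp K R) G ≤ lifeCost W (costT sh C K R) G :=
  sum_le_sum fun n _ => costT_le h K R G n

omit [DecidableEq ε] in
/-- late-merger consistency `ConsistentTH` reads the constants only through the merger allowance `n₁` [folklore] -/
theorem consistentTH_iff_of_n₁_eq (hn : C.n₁ = Cp.n₁) (K : ℕ) (R : ℕ → ℕ) (D : ℕ) :
    ∀ G : Gen ε, ConsistentTH sh C K R D G ↔ ConsistentTH sh Cp K R D G
  | Gen.born b j => by simp only [ConsistentTH]
  | Gen.renew G e k => by
      simp only [ConsistentTH, consistentTH_iff_of_n₁_eq hn K R D G, hn]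
  | Gen.merge X Y e => by
      simp only [ConsistentTH, consistentTH_iff_of_n₁_eq hn K R D X, consistentTH_iff_of_n₁_eq hn K R D Y, hn]

/-- the shape steps of a late-merger-consistent tagged genealogy are at most the cutoff [folklore] -/
theorem stepT_le_of_consistentTH {K : ℕ} {R : ℕ → ℕ} {D : ℕ} :
    ∀ {G : Gen ε}, ConsistentTH sh C K R D G → ∀ e ∈ G.events, (sh e).step ≤ K
  | Gen.born b j, hc, e, he => by
      simp only [ConsistentTH] at hc
      simp only [Gen.events_born, mem_singleton] at he
      subst he; omega
  | Gen.renew G e h, hc, e', he' => by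
      simp only [ConsistentTH] at hc
      rcases mem_insert.1 he' with rfl | he'
      · omega
      · exact stepT_le_of_consistentTH hc.1 e' he'
  | Gen.merge X Y e, hc, e', he' => by
      simp only [ConsistentTH] at hc
      rcases mem_insert.1 he' with rfl | he'
      · exact hc.2.2.2.2.2.2.2
      · rcases mem_union.1 he' with he' | he'
        · exact stepT_le_of_consistentTH hc.1 e' he'
        · exact stepT_le_of_consistentTH hc.2.1 e' he'

/-- **THE TAGGED CREDITS DO NOT INCREASE** along a refinement (profile base nonnegative up to the cutoff, shape steps
no later than the cutoff). [folklore] -/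
theorem creditsT_le (h : Refines C Cp) {K : ℕ} (g : ℕ → ℝ) (hx : ∀ s, s ≤ K → 0 ≤ Real.log ((g s) ^ 2)⁻¹)
    {G : Gen ε} (hG : ∀ e ∈ G.events, (sh e).step ≤ K) :
    credits (credit C g ∘ sh) G ≤ credits (credit Cp g ∘ sh) G := by
  unfold credits
  exact sum_le_sum fun e he =>
    credit_le h g (sh e) (hx _ (hG e he)) (hx _ ((Nat.sub_le _ _).trans (hG e he)))

/-- **THE TH PRICE SHAPE DOES NOT DECREASE ALONG A REFINEMENT** (`Δ, Λ′ ≥ 0`; partner ages and the padded windows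
are shared; credits down, costs up). [folklore] -/
theorem shapeTH_le (h : Refines C Cp) {Λ' Δ : ℝ} (hΔ : 0 ≤ Δ) (hΛ : 0 ≤ Λ') (R : ℕ → ℕ → ℕ) (g : ℕ → ℕ → ℝ)
    (D K : ℕ) (hx : ∀ s, s ≤ K → 0 ≤ Real.log ((g K s) ^ 2)⁻¹) {G : Gen ε}
    (hG : ∀ e ∈ G.events, (sh e).step ≤ K) :
    shapeTH sh Cp Λ' Δ R g D K G ≤ shapeTH sh C Λ' Δ R g D K G := by
  unfold shapeTH
  rw [dictWT_eq h]
  refine mul_le_mul_of_nonneg_left (mul_le_mul_of_nonneg_left ?_ (pow_nonneg hΛ _)) hΔ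
  exact mul_le_mul (Real.exp_le_exp.2 (neg_le_neg (creditsT_le h (g K) hx hG)))
    (Real.exp_le_exp.2 (lifeCostT_le h _ K (R K) G)) (Real.exp_pos _).le (Real.exp_pos _).le

/-- **THE PRODUCT STEP ON LIVE MEMBERS**: a class price dominated by `∏_{q ∈ S} shapeTH sh Cp … (f q)` over any
indexed family of consistent tagged members is dominated by the same product at any refinement `C`. [folklore] -/
theorem prod_shapeTH_le_of_refines {α : Type*} (h : Refines C Cp) {Λ' Δ : ℝ} (hΔ : 0 ≤ Δ) (hΛ : 0 ≤ Λ')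
    (R : ℕ → ℕ → ℕ) (g : ℕ → ℕ → ℝ) (D K : ℕ) (hx : ∀ s, s ≤ K → 0 ≤ Real.log ((g K s) ^ 2)⁻¹)
    {S : Finset α} (f : α → Gen ε) (hS : ∀ q ∈ S, ConsistentTH sh Cp K (R K) D (f q)) {x : ℝ}
    (hle : x ≤ ∏ q ∈ S, shapeTH sh Cp Λ' Δ R g D K (f q)) : x ≤ ∏ q ∈ S, shapeTH sh C Λ' Δ R g D K (f q) :=
  hle.trans (prod_le_prod (fun q _ => shapeTH_nonneg hΔ hΛ R g D K (f q)) fun q hq =>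
    shapeTH_le h hΔ hΛ R g D K hx (stepT_le_of_consistentTH (hS q hq)))

end Tables

/-! ## §2 The tree-count socket transfers along a refinement -/

section Socket

variable {γ κ : Type*} [DecidableEq γ] {sh : ε → PEv} {C Cp : T4PrintedShapeBanking.Consts} {Λ' Δ l₀ : ℝ}
  {K₀ : ℕ} {R : ℕ → ℕ → ℕ} {g : ℕ → ℕ → ℝ} {Cell : ℕ → ℕ → Finset γ} {Dcap Ncap : ℕ → ℕ} {jstar : ℕ → ℕ} {D : ℕ}
  {Bad' : ℕ → ℝ → Finset κ} {F Rf F' Rf' : ℕ → κ → ℝ} {live : ℕ → κ → Finset (γ × Gen ε)}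

/-- **THE TREE-COUNT SOCKET TRANSFERS ALONG A REFINEMENT.**  If the live members fill `LiveHistoriesTH` at the
transcription's record `Cp`, they fill it at every `C` refining `Cp` (same live data), provided `Δ ≥ 0`, `Λ′ ≥ 0` and
the profile base `log g_{K,s}⁻²` is nonnegative along the runs (the exit asks `≥ 1`).  `consistent`∕`pending` transfer
because the windows `dictWT sh R n₁` coincide; `price`∕`price'` by the product step; the other seven fields do not
mention the constants. [folklore] -/
theorem liveHistoriesTH_of_refines (h : Refines C Cp) (hΔ : 0 ≤ Δ) (hΛ : 0 ≤ Λ')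
    (hx : ∀ K, K₀ ≤ K → ∀ s, s ≤ K → 0 ≤ Real.log ((g K s) ^ 2)⁻¹)
    (H : LiveHistoriesTH sh Cp Λ' Δ l₀ K₀ R g Cell Dcap Ncap jstar D Bad' F Rf F' Rf' live) :
    LiveHistoriesTH sh C Λ' Δ l₀ K₀ R g Cell Dcap Ncap jstar D Bad' F Rf F' Rf' live where
  consistent K q hK hq := (consistentTH_iff_of_n₁_eq h.n₁_eq K (R K) D q.2).2 (H.consistent K q hK hq)
  fresh := H.fresh
  pending K q hK hq := by rw [dictWT_eq h]; exact H.pending K q hK hq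
  cell_mem := H.cell_mem
  canon := H.canon
  old := H.old
  slot_inj := H.slot_inj
  str_inj := H.str_inj
  price K t ht hK c hc :=
    prod_shapeTH_le_of_refines h hΔ hΛ R g D K (hx K hK) Prod.snd
      (fun q hq => H.consistent K q hK ⟨t, ht, c, hc, hq⟩) (H.price K t ht hK c hc)
  price' K t ht hK c hc :=
    prod_shapeTH_le_of_refines h hΔ hΛ R g D K (hx K hK) Prod.snd
      (fun q hq => H.consistent K q hK ⟨t, ht, c, hc, hq⟩) (H.price' K t ht hK c hc)

/-- **THE TREE-COUNT SOCKET AT RE-CHOSEN MARGINS**: filled at `Cp` (nonnegative amplitude), it is filled at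
`withMargins Cp κ₁ E₀ Eb μ` for every choice of the count margins. [folklore] -/
theorem liveHistoriesTH_withMargins (hA : 0 ≤ Cp.A₀) (κ₁ E₀ Eb μ : ℝ) (hΔ : 0 ≤ Δ) (hΛ : 0 ≤ Λ')
    (hx : ∀ K, K₀ ≤ K → ∀ s, s ≤ K → 0 ≤ Real.log ((g K s) ^ 2)⁻¹)
    (H : LiveHistoriesTH sh Cp Λ' Δ l₀ K₀ R g Cell Dcap Ncap jstar D Bad' F Rf F' Rf' live) :
    LiveHistoriesTH sh (withMargins Cp κ₁ E₀ Eb μ) Λ' Δ l₀ K₀ R g Cell Dcap Ncap jstar D Bad' F Rf F' Rf' live :=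
  liveHistoriesTH_of_refines (refines_withMargins hA) hΔ hΛ hx H

end Socket

/-! ## §2b The END in use form: socket at the transcription record, TH exit at any refinement -/

section Exit

variable {γ κ ι : Type*} [DecidableEq γ] [DecidableEq κ] {l₀ : ℝ} {K₀ : ℕ} {π : ℕ → ι → κ}
  {T : ℕ → Finset ι} {A A' : ℕ → ℝ → ι → ℝ} {Bad' : ℕ → ℝ → Finset κ} {dead dead' : ℕ → ℝ → ι → ℝ}
  {F Rf F' Rf' : ℕ → κ → ℝ} {nlow nup mlow mup : ℕ → ℝ → ℝ} {Cn : ℝ}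

/-- **NE7b's TH COUNT EXIT WITH THE SOCKET FILLED AT THE TRANSCRIPTION RECORD.**
`HistorySocketTH.relWeightBound_of_liveHistoriesTH` at symbolic constants `C` refining `Cp`, the tree-count socket
being supplied at `Cp`; every other binder verbatim at `C` (`hx1 : 1 ≤ log g⁻²` supplies the nonnegative profile base
the transfer needs; `Δ ≥ 1`, `Λ′ ≥ 0` are the exit's own).  Conclusion verbatim. [folklore] -/
theorem relWeightBound_of_liveHistoriesTH_refines (sh : ε → PEv) {C Cp : T4PrintedShapeBanking.Consts} {L rr : ℕ}
    {β₀ : ℝ} (href : Refines C Cp) (h : ThresholdOK C L rr β₀) (hμ₀ : 0 < C.μ)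
    (Cell : ℕ → ℕ → Finset γ) {V Λ : ℝ} (hV : 0 ≤ V) (hΛ : 0 < Λ)
    (hcell : ∀ K a, ((Cell K a).card : ℝ) ≤ V * Λ ^ a) (Dcap Ncap : ℕ → ℕ)
    (jstar : ℕ → ℕ) (hj : ∀ K, jstar K ≤ K) {c : ℝ} (hc : 0 < c)
    (hfrac : ∀ K : ℕ, c * K ≤ ((K - jstar K : ℕ) : ℝ)) (D : ℕ) {Δ : ℝ} (hΔ : 1 ≤ Δ)
    (hA : Regeneration l₀ π T A Bad' dead F Rf nlow nup Cn K₀)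
    (hA' : Regeneration l₀ π T A' Bad' dead' F' Rf' mlow mup Cn K₀) (hCn : 0 ≤ Cn)
    (R : ℕ → ℕ → ℕ) (g : ℕ → ℕ → ℝ) (β' : ℕ → ℝ)
    (h27 : ∀ K, K₀ ≤ K → B14.FlowIneq27 (g K) (β' K) β₀ C.p₀ K)
    (h29 : ∀ K, K₀ ≤ K → B14FlowStep.FlowIneq29 (R K) (g K) L (β' K) β₀ K)
    (hR : ∀ K, K₀ ≤ K → ∀ s, s ≤ K → B14.IsRj L rr (g K s) (R K s))
    (hx1 : ∀ K, K₀ ≤ K → ∀ s, s ≤ K → 1 ≤ Real.log ((g K s) ^ 2)⁻¹)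
    (hir : ∀ K, K₀ ≤ K → irThresholdTH sh C L rr β₀ D ≤ Real.log ((g K K) ^ 2)⁻¹)
    (hP : ∀ K s, 0 ≤ p0Profile C.A₀ C.p₀ (g K s))
    {ηplus : ℝ} (hηplus : 0 ≤ ηplus) (hr : Λ * Real.exp (ηplus - C.κ₁) < 1)
    {Λ' : ℝ} (hΛ0 : 0 ≤ Λ') (h1 : Λ' * Real.exp (-C.κ₁) * Real.exp ηplus < 1)
    (hxr : (Real.exp (-C.E₀) + Real.exp (-C.E₀) * birthMass C *
          (Λ' * Real.exp (-C.κ₁) / (1 - Λ' * Real.exp (-C.κ₁) * Real.exp ηplus))) * Real.exp ηplus ≤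
        Real.exp ηplus - 1)
    {live : ℕ → κ → Finset (γ × Gen ε)}
    (H : LiveHistoriesTH sh Cp Λ' Δ l₀ K₀ R g Cell Dcap Ncap jstar D Bad' F Rf F' Rf' live) :
    ∃ K₁, K₀ ≤ K₁ ∧ RelWeightBound l₀ T A A' (fun K t => if K₁ ≤ K then badOfClass π T Bad' K t else ∅)
      (Set.indicator {K | K₁ ≤ K}
        (fun K => Cn * recordsBudget (Δ * Real.exp (C.κ₁ * (D : ℝ)) * birthMass C) C.κ₁ V Λ ηplus jstar K)) :=
  relWeightBound_of_liveHistoriesTH sh h hμ₀ Cell hV hΛ hcell Dcap Ncap jstar hj hc hfrac D hΔ hA hA' hCn R g β' h27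
    h29 hR hx1 hir hP hηplus hr hΛ0 h1 hxr
    (liveHistoriesTH_of_refines href (zero_le_one.trans hΔ) hΛ0
      (fun K hK s hs => zero_le_one.trans (hx1 K hK s hs)) H)

end Exit

/-! ## §3 Sanity -/

namespace Sanity

/-- the transfer is not vacuous: a tree-count socket instance at the cross-read's toy record `C₀`, re-margined with bank
rate `5`, from the instance at `C₀` (empty live data, tags `PEv × ℕ`, `sh = Prod.fst`). [folklore] -/
example (Λ' Δ l₀ : ℝ) (hΔ : 0 ≤ Δ) (hΛ : 0 ≤ Λ') (K₀ D : ℕ) (R : ℕ → ℕ → ℕ) (Cell : ℕ → ℕ → Finset ℕ)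
    (Dcap Ncap jstar : ℕ → ℕ) (F Rf F' Rf' : ℕ → Unit → ℝ)
    (H : LiveHistoriesTH (Prod.fst : PEv × ℕ → PEv) XreadC4.C₀ Λ' Δ l₀ K₀ R (fun _ _ => Real.exp (-1)) Cell Dcap Ncap
      jstar D (fun _ _ => (∅ : Finset Unit)) F Rf F' Rf' (fun _ _ => (∅ : Finset (ℕ × Gen (PEv × ℕ))))) :
    LiveHistoriesTH (Prod.fst : PEv × ℕ → PEv) (withMargins XreadC4.C₀ 5 0 0 0) Λ' Δ l₀ K₀ R
      (fun _ _ => Real.exp (-1)) Cell Dcap Ncap jstar D (fun _ _ => (∅ : Finset Unit)) F Rf F' Rf'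
      (fun _ _ => (∅ : Finset (ℕ × Gen (PEv × ℕ)))) :=
  liveHistoriesTH_withMargins (show (0 : ℝ) ≤ XreadC4.C₀.A₀ from le_rfl) 5 0 0 0 hΔ hΛ
    (fun K _ s _ => by
      show 0 ≤ Real.log ((Real.exp (-1)) ^ 2)⁻¹
      rw [Real.log_inv, neg_nonneg, ← Real.exp_nat_mul, Real.log_exp]; norm_num) H

end Sanity

end

end Summit.QuantumFields.BalabanUV.T4Continuum.HistoryConstantsExistTH
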